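import Summits.QuantumFields.BalabanUV.Beta.TorusBallMeanValue

/-!
# `Summit.QuantumFields.BalabanUV.Beta.LatticeNewtonPotentialD4` — AN EXPLICIT LATTICE-SUPERHARMONIC NEWTON POTENTIAL IN FOUR DIMENSIONS:
# on the unit torus `Π_μ ℤ/N_μ` (d = 4), below half the period, the profile `ψ(x) = 1/(|x − x₀|² + 3)` satisfies
# `Σ_μ (ψ(x+e_μ) + ψ(x−e_μ)) ≤ 8·ψ(x)` (superharmonic for the unit nearest-neighbour Laplacian), with defect EXACTLY `2/3` at the centre —
# the key lemma of road P3's kernel proof of the harmonic-measure bound (HMB) for the MODEL in Bałaban's dimension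

HONEST FRAMING (page 1 of everything in this cell).  Discharging `FlowStep.BetaPertH` would make Bałaban's ultraviolet
stability UNCONDITIONAL — a constructive-QFT result; it is NOT the continuum limit and NOT the Clay problem.  This module
discharges nothing of `BetaPertH`; it is [folklore] lattice arithmetic and one rational-function inequality, kernel-checked, by CO-OWNER #3
of binder row D4 (unit `b2b-balaban-beta-d4-p3`, road P3 «reduction road», gen 12).  HONEST DEPENDENCY: continuum YM on T⁴ ⇐ BetaPertH ∧
nine spine estimates (0/9 proved); BetaPertH ⇐ (D1) ∧ (D4) ∧ CAP+tail; G-an2-4 gates asym, D1 and NE2/3/4.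

THE POINT.  After `MeanValueBinderOfPoissonBound`, O.2 item (ii-b) for the MODEL (constant weights) is the ONE bound (HMB)
`poisson₁ (C_n(x₀)) x₀ y ≤ K₀/n^{d−1}`.  The classical proof compares the Dirichlet Green's function with pole at the centre to the
Newtonian potential `|x|^{2−d}`; on the lattice `|x|^{2−d}` is only asymptotically harmonic, but the SMOOTHED potential
`(|x|² + a)^{−(d−2)/2}` is strictly superharmonic in the continuum (`Δ = −d·a·(d−2)(|x|²+a)^{−d/2−1}`) with a margin of the same order
`|x|^{−d−2}` as the lattice correction, so for a suitable `a` it is LATTICE-superharmonic everywhere.  For `d = 4`, `a = 3` works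
and the proof is pure algebra: with `q = |x − x₀|²`, `Q = q + 4`, `t_μ = δ_μ(x,x₀)²` (so `Σ_μ t_μ = q`) and the centred step
`|x ± e_μ − x₀|² = q + 1 ± 2r_μ`, `r_μ² = t_μ` (no wrap-around below half the period):
  `ψ(x+e_μ) + ψ(x−e_μ) = 1/(Q + 2r_μ) + 1/(Q − 2r_μ) = 2Q/(Q² − 4t_μ) ≤ 2/Q + 8t_μ/(Q(Q² − 4q))`  (chord of a convex function,
  `⟺ 0 ≤ 16t_μ(q − t_μ)`), and summing, `Σ_μ ≤ (8Q² − 24q)/(Q(Q² − 4q)) ≤ 8/(Q − 1) = 8ψ(x)` (`⟺ 0 ≤ 8q + 128`).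
At `x = x₀` (`q = 0`): `Σ_μ = 8/4 = 2 = 8ψ(x₀) − 2/3`.
* §1 one-dimensional circular arithmetic: the SIGNED step `circAbs(t ± 1) = |r ± 1|` with `|r| = circAbs t` below half the period
  (`exists_signed_step`);
* §2 on the torus (any `d`): `sqRad x₀ (x ± e_μ) = sqRad x₀ x + 1 ± 2r` with `r² = δ_μ(x,x₀)²` (`sqRad_up_dn_signed`);
* §3 `d = 4`: the real-variable inequalities `pair_eq` (`1/(Q+2r) + 1/(Q−2r) = 2Q/(Q²−4r²)`), `chord_bound`, `sum_bound_d4`;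
* §4 **`newton_superharmonic_d4`** — for every `x` with `2(δ_μ(x,x₀) + 1) ≤ N_μ` for all `μ`:
  `Σ_μ (ψ(x+e_μ) + ψ(x−e_μ)) ≤ 8ψ(x)`, `ψ = 1/(sqRad x₀ · + 3)` (through a defining hypothesis `hψ`); **`newton_sum_centre_d4`** — at
  `x₀` the neighbour sum is exactly `2` (defect `8/3 − 2 = 2/3`).
The consumer (`HarmonicMeasureBoundD4`) turns this into `W·ψ ≥ Nψ` for the unit weight (file 15b's bond sums), compares the Green's
function of the ball `C_n(x₀)` with `(3/2)(ψ − 1/((n+1)²+3))⁺` (`GraphGreenFunction.green_le_of_supersolution`) and reads off (HMB)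
with `K₀ = 48` by last exit + symmetry.

LOCATORS (shape only, nothing printed asserted; ABSOLUTE RULE): [Balaban1985BackgroundPropagators] Thm 3.1 (3.42) p. 397;
[Balaban1984PropagatorsII] Prop. 2.2 (2.67) p. 234.  Row D4: NO class change (critical-path width 0; D4 DISCHARGE NO DATE); NOT
BetaPertH, NOT continuum, NOT Clay, NOT summit progress.
-/

open scoped BigOperators
open Finset

namespace Summit.QuantumFields.BalabanUV.Beta.LatticeNewtonPotentialD4

open Literature.MathematicalPhysics.QuantumFieldTheory.Balaban1983to89
open Literature.MathematicalPhysics.QuantumFieldTheory.Balaban1983to89.B9Thm37GluePU (bsrc btgt bsrc_apply btgt_apply)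
open B4TorusKernel.MultiPeriod (circAbs circAbs_nonneg centre abs_add_mul_centre circAbs_add_mul)
open B4Sect5Torus (ccoord)
open B5TorusCover (UT)
open B5Leibniz121 (up dn)
open Summit.QuantumFields.BalabanUV.Beta.TorusBoxProfile (circAbs_eq_abs_of_two_mul_abs_le cdist_up_self cdist_dn_self
  cdist_up_ne cdist_dn_ne)
open Summit.QuantumFields.BalabanUV.Beta.TorusBallMeanValue (sqRad erad ccoord_cast' ccoord_le_erad)

noncomputable section

/-! ## §1 One-dimensional circular arithmetic: the signed step below half the period -/

/-- **The signed step.**  If `M ≥ 1` and `2(dist(t, Mℤ) + 1) ≤ M` then, with `r` the centred representative of `t`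
(`|r| = dist(t, Mℤ)`), `dist(t+1, Mℤ) = |r + 1|` and `dist(t−1, Mℤ) = |r − 1|`. [folklore] -/
theorem exists_signed_step {M : ℕ} (hM1 : 1 ≤ M) (t : ℤ) (h : 2 * (circAbs M t + 1) ≤ (M : ℤ)) :
    ∃ r : ℤ, |r| = circAbs M t ∧ circAbs M (t + 1) = |r + 1| ∧ circAbs M (t - 1) = |r - 1| := by
  set r : ℤ := t + M * centre M t with hr
  have habs : |r| = circAbs M t := abs_add_mul_centre hM1 t
  refine ⟨r, habs, ?_, ?_⟩
  · have e : t + 1 = (r + 1) + (M : ℤ) * (-centre M t) := by rw [hr]; ring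
    rw [e, circAbs_add_mul]
    refine circAbs_eq_abs_of_two_mul_abs_le hM1 _ ?_
    have h1 : |r + 1| ≤ |r| + 1 := by simpa using abs_add_le r 1
    linarith [habs ▸ h1]
  · have e : t - 1 = (r - 1) + (M : ℤ) * (-centre M t) := by rw [hr]; ring
    rw [e, circAbs_add_mul]
    refine circAbs_eq_abs_of_two_mul_abs_le hM1 _ ?_
    have h1 : |r - 1| ≤ |r| + 1 := by simpa using abs_sub r 1
    linarith [habs ▸ h1]

/-! ## §2 The squared radius of the two μ-neighbours, with the sign -/

section Torus

variable {d : ℕ} {N : Fin d → ℕ} [∀ i, NeZero (N i)]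

/-- **`|x ± e_μ − x₀|² = |x − x₀|² + 1 ± 2r_μ` with `r_μ² = δ_μ(x,x₀)²`** (below half the period in the `μ`-th coordinate:
`2(δ_μ(x,x₀) + 1) ≤ N_μ`). [folklore] -/
theorem sqRad_up_dn_signed (x₀ x : UT N) (μ : Fin d)
    (hwrap : 2 * ((ccoord N (UT.toSite N x) (UT.toSite N x₀) μ : ℕ) + 1) ≤ N μ) :
    ∃ r : ℤ, r ^ 2 = ((ccoord N (UT.toSite N x) (UT.toSite N x₀) μ : ℕ) : ℤ) ^ 2 ∧
      ((sqRad x₀ (up x μ) : ℕ) : ℤ) = sqRad x₀ x + 1 + 2 * r ∧ ((sqRad x₀ (dn x μ) : ℕ) : ℤ) = sqRad x₀ x + 1 - 2 * r := by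
  have hc := ccoord_cast' x x₀ μ
  set t : ℤ := ((UT.toSite N x μ).val : ℤ) - ((UT.toSite N x₀ μ).val : ℤ) with ht
  have hwrap' : 2 * (circAbs (N μ) t + 1) ≤ (N μ : ℤ) := by
    rw [← hc]; exact_mod_cast hwrap
  obtain ⟨r, hr, hup, hdn⟩ := exists_signed_step (UT.one_le N μ) t hwrap'
  refine ⟨r, by rw [hc, ← hr, sq_abs], ?_, ?_⟩
  · -- the difference of the two sums is the difference of the μ-terms
    have hdiff : ((sqRad x₀ (up x μ) : ℕ) : ℤ) - sqRad x₀ x = (r + 1) ^ 2 - r ^ 2 := by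
      simp only [sqRad, Nat.cast_sum, Nat.cast_pow]
      rw [← Finset.sum_sub_distrib, Finset.sum_eq_single μ]
      · rw [ccoord_cast', ccoord_cast', cdist_up_self, ← ht, hup, ← hr, sq_abs, sq_abs]
      · intro ν _ hν
        rw [ccoord_cast', ccoord_cast', cdist_up_ne x x₀ hν, sub_self]
      · intro h; exact absurd (Finset.mem_univ μ) h
    linarith [hdiff]
  · have hdiff : ((sqRad x₀ (dn x μ) : ℕ) : ℤ) - sqRad x₀ x = (r - 1) ^ 2 - r ^ 2 := by
      simp only [sqRad, Nat.cast_sum, Nat.cast_pow]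
      rw [← Finset.sum_sub_distrib, Finset.sum_eq_single μ]
      · rw [ccoord_cast', ccoord_cast', cdist_dn_self, ← ht, hdn, ← hr, sq_abs, sq_abs]
      · intro ν _ hν
        rw [ccoord_cast', ccoord_cast', cdist_dn_ne x x₀ hν, sub_self]
      · intro h; exact absurd (Finset.mem_univ μ) h
    linarith [hdiff]

omit [∀ i, NeZero (N i)] in
/-- A coordinate distance squared is at most the squared radius: `δ_μ² ≤ Σ_ν δ_ν²`. [folklore] -/
theorem ccoord_sq_le_sqRad (x₀ x : UT N) (μ : Fin d) :
    (ccoord N (UT.toSite N x) (UT.toSite N x₀) μ : ℕ) ^ 2 ≤ sqRad x₀ x :=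
  Finset.single_le_sum (f := fun ν => ccoord N (UT.toSite N x) (UT.toSite N x₀) ν ^ 2) (fun _ _ => Nat.zero_le _)
    (Finset.mem_univ μ)

end Torus

/-! ## §3 The real-variable inequalities (d = 4) -/

/-- `1/(Q + 2r) + 1/(Q − 2r) = 2Q/(Q² − 4r²)` when both denominators are positive. [folklore] -/
theorem pair_eq {Q r : ℝ} (h1 : 0 < Q + 2 * r) (h2 : 0 < Q - 2 * r) :
    1 / (Q + 2 * r) + 1 / (Q - 2 * r) = 2 * Q / (Q ^ 2 - 4 * r ^ 2) := by
  have h3 : Q ^ 2 - 4 * r ^ 2 = (Q + 2 * r) * (Q - 2 * r) := by ring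
  rw [h3]
  field_simp
  ring

/-- **The chord bound** for the convex `t ↦ 2Q/(Q² − 4t)` on `[0, q]`: `2Q/(Q² − 4t) ≤ 2/Q + 8t/(Q(Q² − 4q))` for `0 ≤ t ≤ q`,
`Q > 0`, `Q² − 4q > 0` (equivalently `0 ≤ 16t(q − t)`). [folklore] -/
theorem chord_bound {Q q t : ℝ} (hQ : 0 < Q) (hD : 0 < Q ^ 2 - 4 * q) (ht0 : 0 ≤ t) (htq : t ≤ q) :
    2 * Q / (Q ^ 2 - 4 * t) ≤ 2 / Q + 8 * t / (Q * (Q ^ 2 - 4 * q)) := by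
  have hDt : 0 < Q ^ 2 - 4 * t := by linarith
  have e : 2 * Q / (Q ^ 2 - 4 * t) = 2 / Q + 8 * t / (Q * (Q ^ 2 - 4 * t)) := by
    field_simp
    ring
  rw [e]
  have h8t : (0 : ℝ) ≤ 8 * t := by linarith
  have hle : Q * (Q ^ 2 - 4 * q) ≤ Q * (Q ^ 2 - 4 * t) := mul_le_mul_of_nonneg_left (by linarith) hQ.le
  have h := div_le_div_of_nonneg_left h8t (mul_pos hQ hD) hle
  linarith

/-- **The summed bound (d = 4, a = 3)**: with `Q = q + 4`, `8/Q + 8q/(Q(Q² − 4q)) ≤ 8/(Q − 1)` for `q ≥ 0`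
(cross-multiplied: `0 ≤ 8q + 128`). [folklore] -/
theorem sum_bound_d4 {q : ℝ} (hq : 0 ≤ q) :
    8 / (q + 4) + 8 * q / ((q + 4) * ((q + 4) ^ 2 - 4 * q)) ≤ 8 / (q + 4 - 1) := by
  have hQ : 0 < q + 4 := by linarith
  have hD : 0 < (q + 4) ^ 2 - 4 * q := by nlinarith
  have hQ1 : 0 < q + 4 - 1 := by linarith
  rw [div_add_div _ _ hQ.ne' (mul_pos hQ hD).ne', div_le_div_iff₀ (mul_pos hQ (mul_pos hQ hD)) hQ1]
  nlinarith [mul_pos hQ hD, mul_pos hQ hQ, sq_nonneg q]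

/-! ## §4 THE NEWTON POTENTIAL `ψ = 1/(|x − x₀|² + 3)` IS LATTICE-SUPERHARMONIC IN d = 4 -/

section D4

variable {N : Fin 4 → ℕ} [∀ i, NeZero (N i)]

/-- **LATTICE SUPERHARMONICITY OF THE SMOOTHED NEWTON POTENTIAL, d = 4.**  On the unit torus `Π_{μ<4} ℤ/N_μ`, let
`ψ(y) = 1/(sqRad x₀ y + 3)` (`sqRad` = `Σ_μ δ_μ(y,x₀)²`, the squared Euclidean length of the centred coordinate differences).
For every `x` below half the period around `x₀` (`2(δ_μ(x,x₀) + 1) ≤ N_μ` for all `μ`):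
`Σ_μ (ψ(x + e_μ) + ψ(x − e_μ)) ≤ 8·ψ(x)` — i.e. `ψ` is superharmonic for the unit nearest-neighbour Laplacian there (INCLUDING at
`x = x₀`).  Proof: §2 + `pair_eq` + `chord_bound` termwise (`t_μ = δ_μ² ≤ q = sqRad`), then `sum_bound_d4`. [folklore] -/
theorem newton_superharmonic_d4 (x₀ : UT N) (ψ : UT N → ℝ) (hψ : ∀ y, ψ y = 1 / ((sqRad x₀ y : ℝ) + 3)) (x : UT N)
    (hwrap : ∀ μ, 2 * ((ccoord N (UT.toSite N x) (UT.toSite N x₀) μ : ℕ) + 1) ≤ N μ) :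
    ∑ μ, (ψ (up x μ) + ψ (dn x μ)) ≤ 8 * ψ x := by
  set q : ℝ := (sqRad x₀ x : ℝ) with hq
  have hq0 : 0 ≤ q := by positivity
  set Q : ℝ := q + 4 with hQ
  have hQ0 : 0 < Q := by rw [hQ]; linarith
  have hD : 0 < Q ^ 2 - 4 * q := by rw [hQ]; nlinarith
  -- termwise bound
  have hterm : ∀ μ, ψ (up x μ) + ψ (dn x μ) ≤
      2 / Q + 8 * (((ccoord N (UT.toSite N x) (UT.toSite N x₀) μ : ℕ) : ℝ) ^ 2) / (Q * (Q ^ 2 - 4 * q)) := by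
    intro μ
    obtain ⟨r, hr2, hup, hdn⟩ := sqRad_up_dn_signed x₀ x μ (hwrap μ)
    set cμ : ℝ := ((ccoord N (UT.toSite N x) (UT.toSite N x₀) μ : ℕ) : ℝ) with hcμ
    have hr2' : (r : ℝ) ^ 2 = cμ ^ 2 := by
      have := congrArg (fun z : ℤ => (z : ℝ)) hr2
      simpa [hcμ] using this
    have hup' : ((sqRad x₀ (up x μ) : ℕ) : ℝ) = q + 1 + 2 * r := by
      have := congrArg (fun z : ℤ => (z : ℝ)) hup
      simpa [hq] using this
    have hdn' : ((sqRad x₀ (dn x μ) : ℕ) : ℝ) = q + 1 - 2 * r := by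
      have := congrArg (fun z : ℤ => (z : ℝ)) hdn
      simpa [hq] using this
    -- `t_μ = c_μ² ≤ q`, and `Q ± 2r > 0` since `Q ≥ c_μ² + 4 > 2|r|`
    have htq : cμ ^ 2 ≤ q := by
      have := ccoord_sq_le_sqRad x₀ x μ
      rw [hcμ, hq]; exact_mod_cast this
    have hpos1 : 0 < Q + 2 * r := by nlinarith [sq_nonneg ((r : ℝ) + 1)]
    have hpos2 : 0 < Q - 2 * r := by nlinarith [sq_nonneg ((r : ℝ) - 1)]
    rw [hψ (up x μ), hψ (dn x μ), hup', hdn']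
    have e1 : q + 1 + 2 * (r : ℝ) + 3 = Q + 2 * r := by rw [hQ]; ring
    have e2 : q + 1 - 2 * (r : ℝ) + 3 = Q - 2 * r := by rw [hQ]; ring
    rw [e1, e2, pair_eq hpos1 hpos2, hr2']
    exact chord_bound hQ0 hD (sq_nonneg _) htq
  -- sum over the four axes: `Σ_μ t_μ = q`
  have hsumt : ∑ μ : Fin 4, ((ccoord N (UT.toSite N x) (UT.toSite N x₀) μ : ℕ) : ℝ) ^ 2 = q := by
    rw [hq, sqRad]; push_cast; rfl
  calc ∑ μ, (ψ (up x μ) + ψ (dn x μ))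
      ≤ ∑ μ : Fin 4, (2 / Q + 8 * (((ccoord N (UT.toSite N x) (UT.toSite N x₀) μ : ℕ) : ℝ) ^ 2) / (Q * (Q ^ 2 - 4 * q))) :=
        Finset.sum_le_sum fun μ _ => hterm μ
    _ = 8 / Q + 8 * q / (Q * (Q ^ 2 - 4 * q)) := by
        rw [Finset.sum_add_distrib, Finset.sum_const, Finset.card_univ, Fintype.card_fin, ← Finset.sum_div, ← Finset.mul_sum, hsumt]
        norm_num
        ring
    _ ≤ 8 / (Q - 1) := by rw [hQ]; exact sum_bound_d4 hq0
    _ = 8 * ψ x := by rw [hψ x, hQ, hq]; ring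

/-- **THE DEFECT AT THE CENTRE**: `Σ_μ (ψ(x₀ + e_μ) + ψ(x₀ − e_μ)) = 2` (each neighbour has `sqRad = 1`, `ψ = 1/4`), while
`8ψ(x₀) = 8/3`; so `8ψ(x₀) − Σ_μ ψ(x₀ ± e_μ) = 2/3`.  Needs `N_μ ≥ 2`. [folklore] -/
theorem newton_sum_centre_d4 (x₀ : UT N) (ψ : UT N → ℝ) (hψ : ∀ y, ψ y = 1 / ((sqRad x₀ y : ℝ) + 3))
    (hN : ∀ μ, 2 ≤ N μ) : ∑ μ, (ψ (up x₀ μ) + ψ (dn x₀ μ)) = 2 := by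
  have h0 : sqRad x₀ x₀ = 0 := Finset.sum_eq_zero fun ν _ => by rw [B4Sect5Torus.ccoord_self]; rfl
  have hterm : ∀ μ, ψ (up x₀ μ) + ψ (dn x₀ μ) = 1 / 2 := by
    intro μ
    have hc0 : ccoord N (UT.toSite N x₀) (UT.toSite N x₀) μ = 0 := B4Sect5Torus.ccoord_self N _ μ
    obtain ⟨r, hr2, hup, hdn⟩ := sqRad_up_dn_signed x₀ x₀ μ (by rw [hc0]; simpa using hN μ)
    rw [hc0] at hr2
    have hr0 : r = 0 := by simpa using hr2
    rw [hr0, h0] at hup hdn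
    have hup1 : sqRad x₀ (up x₀ μ) = 1 := by push_cast at hup; omega
    have hdn1 : sqRad x₀ (dn x₀ μ) = 1 := by push_cast at hdn; omega
    rw [hψ, hψ, hup1, hdn1]
    norm_num
  rw [Finset.sum_congr rfl fun μ _ => hterm μ, Finset.sum_const, Finset.card_univ, Fintype.card_fin]
  norm_num

omit [∀ i, NeZero (N i)] in
/-- `ψ(x₀) = 1/3`. [folklore] -/
theorem newton_centre_d4 (x₀ : UT N) (ψ : UT N → ℝ) (hψ : ∀ y, ψ y = 1 / ((sqRad x₀ y : ℝ) + 3)) : ψ x₀ = 1 / 3 := by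
  have h0 : sqRad x₀ x₀ = 0 := Finset.sum_eq_zero fun ν _ => by rw [B4Sect5Torus.ccoord_self]; rfl
  rw [hψ, h0]; norm_num

end D4

end

end Summit.QuantumFields.BalabanUV.Beta.LatticeNewtonPotentialD4
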